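import Summits.BirchSwinnertonDyer.BirchSwinnertonDyer.Theorems.GenusKolyvaginAtTwoTorsionCellSELNegTwistEven
import Summits.BirchSwinnertonDyer.BirchSwinnertonDyer.Theorems.GenusKolyvaginAtTwoTorsionCellD0ParityCount
import HarnessLib

/-!
# SEL (iso-class Selmer pair law), C1-I: the extra relaxed class `z` exists and its type is pinned by reciprocity

Crux R″ `RankOneTwoTorsionResidualAtTwo` (stmt-27478), LINE 49 «full_vertex», SUPPORT stub SEL
`IsoClassSelmerPairLawAtTwo`, the `C₁` half (LEAD memo `Cruxes/…/Lines/torsion_cell_full_vertex_SEL_C1_road_g36.md`,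
§2 (R3)–(R4)).  Setting: `E/ℚ` with rational `2`-torsion `e₁ < e₂ < e₃`, rank `0`, `Ш(E)[2] = 0`, good reduction and
unit root differences off `S ∋ 2`, and ONE prime `q₀ ∉ S`, `q₀ ≡ 3 (mod 4)`, full-admissible (`δ₁, δ₂` non-residues,
`ε = qr_{q₀}(e₂ − e₁)`).

* **`exists_relaxed_odd`** — there is an E-class with components supported on `S ∪ {q₀}`, satisfying `E`'s local
  condition at every prime of `S`, and with a component of ODD valuation at `q₀`: g35's pigeonhole
  `…D0ParityCount.exists_finset_relaxed` (`≥ 8` relaxed classes supported on `S ∪ {q₀}`) against `#Sel⁽²⁾(E) = 4`, the even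
  ones being Selmer by the positivity lemma `pos_of_relaxed_pair` (no Poitou–Tate).
* **`pinned_bits_of_relaxed_odd`** — for ANY such class the `q₀`-parities are `(1+ε, ε)`, the first component is
  NEGATIVE, and `qr_{q₀}`/sign of the components satisfy one linear relation: three instances of the reciprocity lemma
  `sum_descentFormBits_one_eq_zero` (the class, `+κ(T₁)`, `+κ(T₂)`) and a finite check.

Everything is proved; no LINE 49 statement is restated; BSD is not advanced by this file alone.

## References

* [KlagsbrunMazurRubin2013] Z. Klagsbrun, B. Mazur, K. Rubin, Ann. of Math. 178 (2013), Def. 3.3, Thm. 3.9.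
* [SilvermanAEC2009] J. H. Silverman, *The Arithmetic of Elliptic Curves*, 2nd ed., Prop. X.1.4, Thm. X.4.2.
* [Serre1973] J.-P. Serre, *A Course in Arithmetic*, Ch. III §2.1 Thm. 3.
-/

noncomputable section

open scoped Classical

namespace Summit.BirchSwinnertonDyer.BirchSwinnertonDyer.Theorems.GenusKolyvaginAtTwo.TorsionCellSEL

open WeierstrassCurve WeierstrassCurve.Affine WeierstrassCurve.Affine.Point
open Literature.NumberTheory.GaloisRepresentations Literature.NumberTheory.EllipticCurves Field
open Literature.NumberTheory.EllipticCurves.TwoDescentLocal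
open Literature.NumberTheory.EllipticCurves.KramerTwoDescent
open Literature.NumberTheory.QuadraticForms
open Summit.BirchSwinnertonDyer.BirchSwinnertonDyer.Theorems.GenusKolyvaginAtTwo.TorsionCellD0
open IsDedekindDomain NumberField Rat.HeightOneSpectrum

variable (E : WeierstrassCurve ℚ) [E.IsElliptic] {e₁ e₂ e₃ : ℚ} (S : Finset ℕ) {q₀ : ℕ} [hq₀ : Fact q₀.Prime]

/-! ## Components of a class -/

omit hq₀ in
/-- Every class of `H¹(ℚ, E[2])` has unit representatives of its two components. [cite: SilvermanAEC2009, Prop. X.1.4] -/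
theorem exists_components (h : E.toAffine.SplitTwoTorsion e₁ e₂ e₃) (c : galH1Torsion E 2) :
    ∃ a b : ℚˣ, kummerEquiv ℚ 2 (E.twoTorsionCharH1 h c) = Additive.ofMul (QuotientGroup.mk a) ∧
      kummerEquiv ℚ 2 (E.twoTorsionCharH1 h.swap₁₂ c) = Additive.ofMul (QuotientGroup.mk b) := by
  obtain ⟨a, ha⟩ := QuotientGroup.mk_surjective (Additive.toMul (kummerEquiv ℚ 2 (E.twoTorsionCharH1 h c)))
  obtain ⟨b, hb⟩ := QuotientGroup.mk_surjective (Additive.toMul (kummerEquiv ℚ 2 (E.twoTorsionCharH1 h.swap₁₂ c)))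
  exact ⟨a, b, by rw [ha]; rfl, by rw [hb]; rfl⟩

omit hq₀ in
/-- The parity character on the class of a unit is the parity bit. [folklore] -/
theorem parityHom_ofMul_mk (ℓ : ℕ) [Fact ℓ.Prime] (a : ℚˣ) :
    parityHom ℓ (Additive.ofMul (QuotientGroup.mk a : SqUnits ℚ)) = parityBit ℓ (a : ℚ) := by
  have : (QuotientGroup.mk a : SqUnits ℚ) = sqClass (a : ℚ) := by
    rw [sqClass_of_ne_zero a.ne_zero]; congr 1; exact Units.ext (by rw [Units.val_mk0])
  rw [this, parityHom_sqClass a.ne_zero]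

/-! ## Existence of an odd relaxed class -/

/-- **An odd relaxed class exists** (pigeonhole against `#Sel⁽²⁾(E) = 4`, no Poitou–Tate).
[cite: KlagsbrunMazurRubin2013, Thm. 3.9] [cite: SilvermanAEC2009, Prop. X.1.4, Thm. X.4.2] -/
theorem exists_relaxed_odd (h : E.toAffine.SplitTwoTorsion e₁ e₂ e₃) (h12 : e₁ < e₂) (h23 : e₂ < e₃)
    (hS : ∀ ℓ ∈ S, ℓ.Prime) (h2S : 2 ∈ S)
    (hgood : ∀ ℓ : ℕ, (hℓ : ℓ.Prime) → ℓ ∉ S → haveI : Fact ℓ.Prime := ⟨hℓ⟩;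
      padicValRat ℓ (e₁ - e₂) = 0 ∧ padicValRat ℓ (e₁ - e₃) = 0 ∧ padicValRat ℓ (e₂ - e₃) = 0)
    (hN : ∀ ℓ : ℕ, ℓ.Prime → ℓ ∉ S → ¬ ℓ ∣ E.conductorNorm ℤ)
    (hrank : E.mordellWeilRank = 0) (hsha : ∀ x ∈ E.sha, (2 : ℕ) • x = 0 → x = 0) (hq₀S : q₀ ∉ S) :
    ∃ a b : ℚˣ,
      (∀ v : HeightOneSpectrum (𝓞 ℚ), natGenerator v ∈ S → E.twoDescentClass h a b ∈ selmerLocalKer E (v.adicCompletion ℚ) 2) ∧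
      (∀ ℓ : ℕ, (hℓ : ℓ.Prime) → ℓ ∉ S → ℓ ≠ q₀ → haveI : Fact ℓ.Prime := ⟨hℓ⟩;
        parityBit ℓ (a : ℚ) = 0 ∧ parityBit ℓ (b : ℚ) = 0) ∧
      ¬ (parityBit q₀ (a : ℚ) = 0 ∧ parityBit q₀ (b : ℚ) = 0) := by
  have hTot : ∀ q ∈ insert q₀ S, q.Prime := fun q hq => by
    rcases Finset.mem_insert.mp hq with rfl | hq
    · exact hq₀.out
    · exact hS q hq
  obtain ⟨X, hX8, hXprop⟩ := exists_finset_relaxed E h S (insert q₀ S) hTot (Finset.subset_insert _ _) (m := 3)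
    (by rw [Finset.card_insert_of_notMem hq₀S]; omega)
  by_contra hall
  push Not at hall
  have he12 : e₁ - e₂ ≠ 0 := sub_ne_zero.mpr h.ne₁₂
  have he13 : e₁ - e₃ ≠ 0 := sub_ne_zero.mpr h.ne₁₃
  have hT₁ : E.twoDescentClass h (Units.mk0 _ (mul_ne_zero he12 he13)) (Units.mk0 _ he12) ∈ E.selmerGroup 2 :=
    twoDescentClass_mem_selmerGroup_T₁ E h _ _ rfl rfl
  -- every class of `X` is Selmer
  have hXsel : ∀ c ∈ X, c ∈ E.selmerGroup 2 := by
    intro c hc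
    obtain ⟨hpar, hloc⟩ := hXprop c hc
    obtain ⟨a, b, ha, hb⟩ := exists_components E h c
    have hc_eq : c = E.twoDescentClass h a b := E.eq_twoDescentClass_of_kummerEquiv_eq h a b ha hb
    have hloc' : ∀ v : HeightOneSpectrum (𝓞 ℚ), natGenerator v ∈ S →
        E.twoDescentClass h a b ∈ selmerLocalKer E (v.adicCompletion ℚ) 2 := fun v hv => hc_eq ▸ hloc v hv
    have hpar' : ∀ ℓ : ℕ, (hℓ : ℓ.Prime) → ℓ ∉ S → ℓ ≠ q₀ → haveI : Fact ℓ.Prime := ⟨hℓ⟩;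
        parityBit ℓ (a : ℚ) = 0 ∧ parityBit ℓ (b : ℚ) = 0 := by
      intro ℓ hℓ hℓS hℓq
      haveI : Fact ℓ.Prime := ⟨hℓ⟩
      have hℓT : ℓ ∉ insert q₀ S := by simp [hℓq, hℓS]
      obtain ⟨h1, h2⟩ := hpar ℓ hℓT
      rw [ha, parityHom_ofMul_mk] at h1
      rw [hb, parityHom_ofMul_mk] at h2
      exact ⟨h1, h2⟩
    have hparq := hall a b hloc' hpar'
    have hsupp : ∀ ℓ : ℕ, (hℓ : ℓ.Prime) → ℓ ∉ S → haveI : Fact ℓ.Prime := ⟨hℓ⟩;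
        parityBit ℓ (a : ℚ) = 0 ∧ parityBit ℓ (b : ℚ) = 0 := by
      intro ℓ hℓ hℓS
      by_cases hℓq : ℓ = q₀
      · subst hℓq; exact hparq
      · exact hpar' ℓ hℓ hℓS hℓq
    -- `c + κ(T₁)` is relaxed and supported on `S`
    have hsupp' : ∀ ℓ : ℕ, (hℓ : ℓ.Prime) → ℓ ∉ S → haveI : Fact ℓ.Prime := ⟨hℓ⟩;
        parityBit ℓ ((a * Units.mk0 _ (mul_ne_zero he12 he13) : ℚˣ) : ℚ) = 0 ∧
          parityBit ℓ ((b * Units.mk0 _ he12 : ℚˣ) : ℚ) = 0 := by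
      intro ℓ hℓ hℓS
      haveI : Fact ℓ.Prime := ⟨hℓ⟩
      obtain ⟨g12, g13, -⟩ := hgood ℓ hℓ hℓS
      obtain ⟨hpa, hpb⟩ := hsupp ℓ hℓ hℓS
      rw [Units.val_mul, Units.val_mul, Units.val_mk0, Units.val_mk0, parityBit_mul a.ne_zero (mul_ne_zero he12 he13),
        parityBit_mul b.ne_zero he12, parityBit_mul he12 he13, hpa, hpb]
      simp [parityBit, g12, g13]
    have hloc'' : ∀ v : HeightOneSpectrum (𝓞 ℚ), natGenerator v ∈ S →
        E.twoDescentClass h (a * Units.mk0 _ (mul_ne_zero he12 he13)) (b * Units.mk0 _ he12) ∈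
          selmerLocalKer E (v.adicCompletion ℚ) 2 := by
      intro v hvS
      rw [twoDescentClass_mul]
      exact add_mem (hloc' v hvS) (((mem_selmerGroup_iff _ _ _).mp hT₁).1 v)
    have hpos : 0 < (a : ℚ) :=
      pos_of_relaxed_pair E S h h12 h23 h2S hgood a b _ _ ha hb
        (E.kummerEquiv_twoTorsionCharH1_twoDescentClass h _ _) (E.kummerEquiv_twoTorsionCharH1_swap_twoDescentClass h _ _)
        (by rw [Units.val_mul, Units.val_mk0]) (by rw [Units.val_mul, Units.val_mk0]) hsupp hsupp'
        (fun v hv => hc_eq ▸ hloc v hv) hloc''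
    exact (mem_selmerGroup_iff_frame E S h h2S h12 h23 hgood hN a b ha hb).mpr
      ⟨hsupp, hloc, (signBit_eq_zero_iff a.ne_zero).mpr hpos⟩
  -- but `#Sel⁽²⁾(E) = 4 < 8 ≤ #X`
  haveI : Finite (E.selmerGroup 2) := E.finite_selmerGroup_holds two_ne_zero
  have hcard := E.natCard_selmerGroup_two_eq_four h hrank hsha
  let f : X → E.selmerGroup 2 := fun c => ⟨c.1, hXsel c.1 c.2⟩
  have hf : Function.Injective f := fun c c' e => Subtype.ext (by simpa [f] using congrArg Subtype.val e)
  have hle := Nat.card_le_card_of_injective f hf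
  rw [hcard, Nat.card_eq_fintype_card, Fintype.card_coe] at hle
  omega

/-! ## The type of an odd relaxed class -/

omit hq₀ in
/-- `𝔽₂`: the three reciprocity constraints pin the type of an odd relaxed class. [folklore] -/
private theorem zmod2_pin (ε α₁ α₂ xa xb sa sb : ZMod 2)
    (e0 : sa * sb + sa + (α₁ * α₂ + α₂ * xa + α₁ * xb + α₁ + α₂) = 0)
    (e1 : sa * (sb + 1) + sa + (α₁ * α₂ + α₂ * (xa + 1) + α₁ * (xb + 1 + ε) + α₁ + α₂) = 0)
    (e2 : sa * (sb + 1) + sa + (α₁ * α₂ + α₂ * (xa + ε) + α₁ * (xb + 1) + α₁ + α₂) = 0)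
    (hne : ¬ (α₁ = 0 ∧ α₂ = 0)) :
    α₁ = 1 + ε ∧ α₂ = ε ∧ sa = 1 ∧ (1 + ε) * (xb + sb) + ε * (xa + sb) = 0 := by
  revert ε α₁ α₂ xa xb sa sb e0 e1 e2 hne; decide

/-- **THE TYPE OF AN ODD RELAXED CLASS IS PINNED**: for an E-class with components `(a, b)` supported on `S ∪ {q₀}`,
satisfying `E`'s local condition at the primes of `S`, with a component of odd valuation at `q₀` (full-admissible,
`ε = qr_{q₀}(e₂−e₁)`): `v_{q₀}(a) ≡ 1 + ε`, `v_{q₀}(b) ≡ ε`, `a < 0`, and `(1+ε)(qr_{q₀}(b) + sgn b) + ε(qr_{q₀}(a) + sgn b) = 0`.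
[cite: KlagsbrunMazurRubin2013, Def. 3.3, Thm. 3.9] [cite: Serre1973, Ch. III §2.1 Thm. 3] -/
theorem pinned_bits_of_relaxed_odd (h : E.toAffine.SplitTwoTorsion e₁ e₂ e₃) (h12 : e₁ < e₂) (h23 : e₂ < e₃) (h2S : 2 ∈ S)
    (hgood : ∀ ℓ : ℕ, (hℓ : ℓ.Prime) → ℓ ∉ S → haveI : Fact ℓ.Prime := ⟨hℓ⟩;
      padicValRat ℓ (e₁ - e₂) = 0 ∧ padicValRat ℓ (e₁ - e₃) = 0 ∧ padicValRat ℓ (e₂ - e₃) = 0)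
    (hq₀S : q₀ ∉ S) (hq₀4 : q₀ % 4 = 3)
    (hδ₁ : qrBit q₀ ((e₁ - e₂) * (e₁ - e₃)) = 1) (hδ₂ : qrBit q₀ ((e₂ - e₁) * (e₂ - e₃)) = 1)
    {ε : ZMod 2} (hε : qrBit q₀ (e₂ - e₁) = ε)
    (a b : ℚˣ)
    (hloc : ∀ v : HeightOneSpectrum (𝓞 ℚ), natGenerator v ∈ S → E.twoDescentClass h a b ∈ selmerLocalKer E (v.adicCompletion ℚ) 2)
    (hsupp : ∀ ℓ : ℕ, (hℓ : ℓ.Prime) → ℓ ∉ S → ℓ ≠ q₀ → haveI : Fact ℓ.Prime := ⟨hℓ⟩;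
      parityBit ℓ (a : ℚ) = 0 ∧ parityBit ℓ (b : ℚ) = 0)
    (hodd : ¬ (parityBit q₀ (a : ℚ) = 0 ∧ parityBit q₀ (b : ℚ) = 0)) :
    parityBit q₀ (a : ℚ) = 1 + ε ∧ parityBit q₀ (b : ℚ) = ε ∧ signBit (a : ℚ) = 1 ∧
      (1 + ε) * (qrBit q₀ (b : ℚ) + signBit (b : ℚ)) + ε * (qrBit q₀ (a : ℚ) + signBit (b : ℚ)) = 0 := by
  have he12 : e₁ - e₂ ≠ 0 := sub_ne_zero.mpr h.ne₁₂
  have he21 : e₂ - e₁ ≠ 0 := sub_ne_zero.mpr h.ne₁₂.symm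
  have he13 : e₁ - e₃ ≠ 0 := sub_ne_zero.mpr h.ne₁₃
  have he23 : e₂ - e₃ ≠ 0 := sub_ne_zero.mpr h.ne₂₃
  have hT₁ : E.twoDescentClass h (Units.mk0 _ (mul_ne_zero he12 he13)) (Units.mk0 _ he12) ∈ E.selmerGroup 2 :=
    twoDescentClass_mem_selmerGroup_T₁ E h _ _ rfl rfl
  have hT₂ : E.twoDescentClass h (Units.mk0 _ he21) (Units.mk0 _ (mul_ne_zero he21 he23)) ∈ E.selmerGroup 2 :=
    twoDescentClass_mem_selmerGroup_T₂ E h _ _ rfl rfl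
  -- parities of the torsion values off `S`
  have hparT : ∀ ℓ : ℕ, (hℓ : ℓ.Prime) → ℓ ∉ S → haveI : Fact ℓ.Prime := ⟨hℓ⟩;
      parityBit ℓ ((e₁ - e₂) * (e₁ - e₃)) = 0 ∧ parityBit ℓ (e₁ - e₂) = 0 ∧ parityBit ℓ (e₂ - e₁) = 0 ∧
        parityBit ℓ ((e₂ - e₁) * (e₂ - e₃)) = 0 := by
    intro ℓ hℓ hℓS
    haveI : Fact ℓ.Prime := ⟨hℓ⟩
    obtain ⟨g12, g13, g23⟩ := hgood ℓ hℓ hℓS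
    have g21 : padicValRat ℓ (e₂ - e₁) = 0 := by rw [← neg_sub, padicValRat.neg, g12]
    refine ⟨?_, ?_, ?_, ?_⟩
    · rw [parityBit_mul he12 he13]; simp [parityBit, g12, g13]
    · simp [parityBit, g12]
    · simp [parityBit, g21]
    · rw [parityBit_mul he21 he23]; simp [parityBit, g21, g23]
  -- the shifted classes are relaxed with the right supports
  have hsupp₁ : ∀ ℓ : ℕ, (hℓ : ℓ.Prime) → ℓ ∉ S → ℓ ≠ q₀ → haveI : Fact ℓ.Prime := ⟨hℓ⟩;
      parityBit ℓ ((a * Units.mk0 _ (mul_ne_zero he12 he13) : ℚˣ) : ℚ) = 0 ∧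
        parityBit ℓ ((b * Units.mk0 _ he12 : ℚˣ) : ℚ) = 0 := by
    intro ℓ hℓ hℓS hℓq
    haveI : Fact ℓ.Prime := ⟨hℓ⟩
    obtain ⟨hpa, hpb⟩ := hsupp ℓ hℓ hℓS hℓq
    obtain ⟨t1, t2, -, -⟩ := hparT ℓ hℓ hℓS
    rw [Units.val_mul, Units.val_mul, Units.val_mk0, Units.val_mk0, parityBit_mul a.ne_zero (mul_ne_zero he12 he13),
      parityBit_mul b.ne_zero he12, hpa, hpb, t1, t2]
    simp
  have hsupp₂ : ∀ ℓ : ℕ, (hℓ : ℓ.Prime) → ℓ ∉ S → ℓ ≠ q₀ → haveI : Fact ℓ.Prime := ⟨hℓ⟩;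
      parityBit ℓ ((a * Units.mk0 _ he21 : ℚˣ) : ℚ) = 0 ∧
        parityBit ℓ ((b * Units.mk0 _ (mul_ne_zero he21 he23) : ℚˣ) : ℚ) = 0 := by
    intro ℓ hℓ hℓS hℓq
    haveI : Fact ℓ.Prime := ⟨hℓ⟩
    obtain ⟨hpa, hpb⟩ := hsupp ℓ hℓ hℓS hℓq
    obtain ⟨-, -, t3, t4⟩ := hparT ℓ hℓ hℓS
    rw [Units.val_mul, Units.val_mul, Units.val_mk0, Units.val_mk0, parityBit_mul a.ne_zero he21,
      parityBit_mul b.ne_zero (mul_ne_zero he21 he23), hpa, hpb, t3, t4]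
    simp
  have hloc₁ : ∀ v : HeightOneSpectrum (𝓞 ℚ), natGenerator v ∈ S →
      E.twoDescentClass h (a * Units.mk0 _ (mul_ne_zero he12 he13)) (b * Units.mk0 _ he12) ∈
        selmerLocalKer E (v.adicCompletion ℚ) 2 := by
    intro v hvS; rw [twoDescentClass_mul]; exact add_mem (hloc v hvS) (((mem_selmerGroup_iff _ _ _).mp hT₁).1 v)
  have hloc₂ : ∀ v : HeightOneSpectrum (𝓞 ℚ), natGenerator v ∈ S →
      E.twoDescentClass h (a * Units.mk0 _ he21) (b * Units.mk0 _ (mul_ne_zero he21 he23)) ∈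
        selmerLocalKer E (v.adicCompletion ℚ) 2 := by
    intro v hvS; rw [twoDescentClass_mul]; exact add_mem (hloc v hvS) (((mem_selmerGroup_iff _ _ _).mp hT₂).1 v)
  -- the three reciprocity constraints
  have e0 := sum_descentFormBits_one_eq_zero E S h h2S hgood hq₀S hq₀4 a b
    (E.kummerEquiv_twoTorsionCharH1_twoDescentClass h _ _) (E.kummerEquiv_twoTorsionCharH1_swap_twoDescentClass h _ _)
    hsupp hloc
  have e1 := sum_descentFormBits_one_eq_zero E S h h2S hgood hq₀S hq₀4 _ _
    (E.kummerEquiv_twoTorsionCharH1_twoDescentClass h _ _) (E.kummerEquiv_twoTorsionCharH1_swap_twoDescentClass h _ _)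
    hsupp₁ hloc₁
  have e2 := sum_descentFormBits_one_eq_zero E S h h2S hgood hq₀S hq₀4 _ _
    (E.kummerEquiv_twoTorsionCharH1_twoDescentClass h _ _) (E.kummerEquiv_twoTorsionCharH1_swap_twoDescentClass h _ _)
    hsupp₂ hloc₂
  -- all bits at `q₀` and `∞`
  have hm1 : qrBit q₀ (-1 : ℚ) = 1 := qrBit_neg_one_eq_one_of_emod_four hq₀4
  have hq12 : qrBit q₀ (e₁ - e₂) = 1 + ε := by rw [← neg_sub, qrBit_neg (p := q₀) he21, hm1, hε]
  obtain ⟨pD₁, p12, p21, pD₂⟩ := hparT q₀ hq₀.out hq₀S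
  have sD₁ : signBit ((e₁ - e₂) * (e₁ - e₃)) = 0 :=
    (signBit_eq_zero_iff (mul_ne_zero he12 he13)).mpr (mul_pos_of_neg_of_neg (sub_neg.mpr h12) (sub_neg.mpr (h12.trans h23)))
  have sD₂ : signBit ((e₂ - e₁) * (e₂ - e₃)) = 1 := by
    unfold signBit; rw [if_pos (mul_neg_of_pos_of_neg (sub_pos.mpr h12) (sub_neg.mpr h23))]
  have s12 : signBit (e₁ - e₂) = 1 := by unfold signBit; rw [if_pos (sub_neg.mpr h12)]
  have s21 : signBit (e₂ - e₁) = 0 := (signBit_eq_zero_iff he21).mpr (sub_pos.mpr h12)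
  simp only [Units.val_mul, Units.val_mk0, parityBit_mul a.ne_zero (mul_ne_zero he12 he13), parityBit_mul b.ne_zero he12,
    parityBit_mul a.ne_zero he21, parityBit_mul b.ne_zero (mul_ne_zero he21 he23),
    qrBit_mul q₀ a.ne_zero (mul_ne_zero he12 he13), qrBit_mul q₀ b.ne_zero he12, qrBit_mul q₀ a.ne_zero he21,
    qrBit_mul q₀ b.ne_zero (mul_ne_zero he21 he23),
    signBit_mul a.ne_zero (mul_ne_zero he12 he13), signBit_mul b.ne_zero he12, signBit_mul a.ne_zero he21,
    signBit_mul b.ne_zero (mul_ne_zero he21 he23), pD₁, p12, p21, pD₂, hδ₁, hδ₂, hq12, hε, sD₁, sD₂, s12, s21,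
    add_zero, mul_one, mul_zero] at e0 e1 e2
  refine zmod2_pin ε _ _ _ _ _ _ ?_ ?_ ?_ hodd
  · linear_combination e0
  · linear_combination e1
  · linear_combination e2

end Summit.BirchSwinnertonDyer.BirchSwinnertonDyer.Theorems.GenusKolyvaginAtTwo.TorsionCellSEL

end
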